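import Summits.HodgeConjecture.HodgeConjecture.Theorems.Ring2HypothesesMTAnchorsCMAnchored
import Summits.HodgeConjecture.HodgeConjecture.Theorems.Ring2HypothesesMTAnchorsAsTyped
import HarnessLib

/-!
# Ring 2 — hypotheses layer: the NAMED separated-base node `MumfordTateCMAnchorsSep` of row b01

HONEST FRAMING: research route conditional on HC_CM; not a corollary; Q11.4-sentence-2 already refuted in dim ≥ 3.

Cell `pub-hodge-ring2` (Hodge ladder STAGE 3: `HC_AV` assuming `HC_CM`), hypotheses layer. LEAD ruling L45.17
(RING2-MAP `## §LEAD (gen 45) P.S. 3`; BINDER-OWNERS §4; INBOX l.965): a NAMED node for the separated-base form of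
row b01's binder is WANTED for the edge census, which reads `Ring2.Hypotheses` edges between NAMED nodes and sees
file-local notations as opaque (L45.2). This file gives the ring2-b01 notation `MTAnchorsSep[]` (parts
`Ring2HypothesesMTAnchorsSeparatedBase` gen 8, `Ring2HypothesesMTAnchorsCMAnchored` gen 9) an importable NAME and
re-keys the landed arrows on it. ZERO new mathematics: one `@[conjecture] def` whose body is `MTAnchorsSep[]` symbol
for symbol, an `Iff.rfl` lemma to the notation, and one-line re-keyings of theorems already in the tree.

WHAT THIS FILE DOES NOT DO. It does NOT re-type the pinned binder `MumfordTateCMAnchors` (`Ring2Hypotheses.lean`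
§1b, dictionary pin 7ab8d878a77e; typer2 §5.73 (a), ENDORSED L45.17): row b01's binder of record stays that
declaration, whose bases range over all smooth irreducible `S` with no separatedness clause; the separated form is
carried INTO the row (`mumfordTateCMAnchors_of_mumfordTateCMAnchorsSep`, forgetting the clause). REV 2 (typer2
gen 50 staged / gen 52 filed, at ring2-b01 gen 10's request; AsTyped landed p245844): the converse `MumfordTateCMAnchors → MumfordTateCMAnchorsSep` — rev 1's
typing residual «smooth irreducible base not separated over ℂ», left unclaimed there — is now ring2-b01's THEOREM
`mumfordTateCMAnchors_iff_sep` (`Ring2HypothesesMTAnchorsAsTyped`, gen 10: Mumford's two-point lemma WITHOUT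
separatedness, `Motives.mumford_smoothCurve_through_two_points_of_irreducibleSpace_of_smooth`), re-keyed on the node
in §4 below (`mumfordTateCMAnchorsSep_iff_mumfordTateCMAnchors`; count once ring2-b01): the node IS row b01's binder
AS TYPED. `HC_CM` (= `Theses.RankFourFaces.CMAbelianHodge`)
does not occur below; no theorem here concludes `HC_AV`; the node is NOT a binder of record (NOT a b-row), NOT a
C-row; «BINDERS OF RECORD 10 · DISCHARGED 0», KIND CITE of rows b01 / b07 — unchanged (LEAD L45.10: rows b01 / b07
ANNOTATED «one row over separated bases modulo two cited theorems», NOT merged).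

CONTENTS.
* §0 the file-local notations `MTAnchorsCurve[]`, `MTAnchorsSep[]`, `MTFlatSep[]` byte for byte from the gen-8 part
  (local notations do not cross files);
* §1 the node `MumfordTateCMAnchorsSep` (`@[conjecture] def`, a HYPOTHESIS wherever used, never asserted) and
  `mumfordTateCMAnchorsSep_iff : MumfordTateCMAnchorsSep ↔ MTAnchorsSep[]` (`Iff.rfl`);
* §2 the row-b01 arrows re-keyed: `→ MumfordTateCMAnchors` (forget separatedness), `↔ MTAnchorsCurve[]`,
  `↔ MTFlatSep[]` (gen 8), and the KIND-CITE binding `deligne1982_cmDenseMumfordTateFamilies → MumfordTateCMAnchorsSep`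
  (BINDER-OWNERS G2 row c8: Deligne 1982 Prop. 6.1 / Charles–Schnell Thm. 11.5.11 in dense global-class form);
* §3 the row-b07 arrows of gen 9 (p240326) re-keyed on the named node: `→ CMAnchoredFamilies` modulo
  `Motives.raynaud1970_abelianScheme_section_projective` (c20), `← CMAnchoredFamilies` modulo
  `Motives.catanese2002_abelianFibres_of_abelianFibre` (c21), `↔` modulo both — the cited records are DISPLAYED as
  hypotheses, never asserted;
* §4 (rev 2) the binder AS TYPED re-keyed: `MumfordTateCMAnchors → MumfordTateCMAnchorsSep` and
  `MumfordTateCMAnchorsSep ↔ MumfordTateCMAnchors` (ring2-b01 gen 10's `mumfordTateCMAnchors_iff_sep`).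

No `sorry`; no new named fact; every theorem is a one-line composition of tree theorems (count once ring2-b01 for
the mathematics; this file only names). Authorship per L45.17: ring2-b01 first, typer2 fallback.

References: [CharlesSchnell2014Notes] Thm. 11.5.11 (pp. 516–518); [Deligne1982HodgeCycles] Prop. 6.1;
[MumfordAV1970] §6 Lemma; [GortzWedhorn2023] Thm. 27.291 (= [Raynaud1970] XI 1.4); [Catanese2002DeformationTypes]
Thm. 4.1 / 4.6; [Abdulali1994FamiliesAV] p. 1122.
-/

-- every declaration of this problem lives in `Summit.HodgeConjecture.HodgeConjecture.…` (summit = sub-problem)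
set_option linter.dupNamespace false

noncomputable section

open CategoryTheory AlgebraicGeometry Topology
open Literature.AlgebraicGeometry Literature.AlgebraicGeometry.Motives Literature.AlgebraicGeometry.HodgeTheory
open Literature.AlgebraicGeometry.Deligne1982 (cmLocus deligne1982_cmDenseMumfordTateFamilies)

namespace Summit.HodgeConjecture.HodgeConjecture.Ring2.Hypotheses

/-! ## §0 File-local notations (byte for byte from `Ring2HypothesesMTAnchorsSeparatedBase`; no definition is introduced) -/

/-- `CurveAnchorsFor[A, p, c]` — the body of `MumfordTateCMAnchors` for the class `c`, base additionally AFFINE of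
topological Krull dimension `≤ 1` (verbatim the gen-7/8 notation). Local notation only. -/
local notation3 (prettyPrint := false) "CurveAnchorsFor[" A ", " p ", " c "]" =>
  ∃ (𝒳 S : SchemeOver ℂ) (f : 𝒳 ⟶ S) (s₁ s₀ : ComplexPoints S) (e : AbelianVariety.X A ≅ fiberOver f s₁)
    (W : complexBetti 𝒳 (2 * p)) (A₀ : AbelianVariety ℂ),
    IsSmoothProjectiveFamily f (AbelianVariety.dim A) ∧ IrreducibleSpace S.left ∧
    AlgebraicGeometry.Smooth S.hom ∧ IsAffine S.left ∧ topologicalKrullDim S.left ≤ 1 ∧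
    (∀ s : ComplexPoints S, ∃ A' : AbelianVariety ℂ,
      A'.dim = AbelianVariety.dim A ∧ Nonempty (A'.X ≅ fiberOver f s)) ∧
    (∀ s : ComplexPoints S, IsRationalClass (complexBetti.map (fiberι f s) (2 * p) W) ∧
      IsOfHodgeType (AbelianVariety.dim A) (fiberOver f s) (2 * p) p p
        (complexBetti.map (fiberι f s) (2 * p) W)) ∧
    complexBetti.map e.hom (2 * p) (complexBetti.map (fiberι f s₁) (2 * p) W) = c ∧
    A₀.dim = AbelianVariety.dim A ∧ Nonempty (A₀.X ≅ fiberOver f s₀) ∧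
    (∃ E : Subalgebra ℚ A₀.endAlgebra, IsReduced ↥E ∧ (∀ x ∈ E, ∀ y ∈ E, x * y = y * x) ∧
      Module.finrank ℚ ↥E = 2 * A₀.dim)

/-- `MTAnchorsCurve[]` — `MumfordTateCMAnchors` OVER CURVE BASES (verbatim the gen-7/8 notation). Local notation only. -/
local notation3 (prettyPrint := false) "MTAnchorsCurve[]" =>
  ∀ (A : AbelianVariety ℂ), IsSmoothProjective A.dim A.X →
    ∀ (p : ℕ) (c : complexBetti A.X (2 * p)), IsRationalClass c →
      IsOfHodgeType A.dim A.X (2 * p) p p c → CurveAnchorsFor[A, p, c]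

/-- `MTAnchorsSep[]` — the body of `MumfordTateCMAnchors` with ONE clause added: the base `S` is SEPARATED over `ℂ`
(`IsSeparated S.hom`) (verbatim the gen-8/9 notation). Local notation only. -/
local notation3 (prettyPrint := false) "MTAnchorsSep[]" =>
  ∀ (A : AbelianVariety ℂ), IsSmoothProjective A.dim A.X →
    ∀ (p : ℕ) (c : complexBetti A.X (2 * p)), IsRationalClass c →
      IsOfHodgeType A.dim A.X (2 * p) p p c →
        ∃ (𝒳 S : SchemeOver ℂ) (f : 𝒳 ⟶ S) (s₁ s₀ : ComplexPoints S) (e : A.X ≅ fiberOver f s₁)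
          (W : complexBetti 𝒳 (2 * p)) (A₀ : AbelianVariety ℂ),
          IsSmoothProjectiveFamily f A.dim ∧ IrreducibleSpace S.left ∧ AlgebraicGeometry.Smooth S.hom ∧
          IsSeparated S.hom ∧
          (∀ s : ComplexPoints S, ∃ A' : AbelianVariety ℂ, A'.dim = A.dim ∧ Nonempty (A'.X ≅ fiberOver f s)) ∧
          (∀ s : ComplexPoints S, IsRationalClass (complexBetti.map (fiberι f s) (2 * p) W) ∧
            IsOfHodgeType A.dim (fiberOver f s) (2 * p) p p (complexBetti.map (fiberι f s) (2 * p) W)) ∧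
          complexBetti.map e.hom (2 * p) (complexBetti.map (fiberι f s₁) (2 * p) W) = c ∧
          A₀.dim = A.dim ∧ Nonempty (A₀.X ≅ fiberOver f s₀) ∧
          (∃ E : Subalgebra ℚ A₀.endAlgebra, IsReduced ↥E ∧ (∀ x ∈ E, ∀ y ∈ E, x * y = y * x) ∧
            Module.finrank ℚ ↥E = 2 * A₀.dim)

/-- `MTFlatSep[]` — Charles–Schnell Thm. 11.5.11 (a) + flat-section (b) + ONE CM point over a smooth irreducible
SEPARATED base (verbatim the gen-8/9 notation). Local notation only. -/
local notation3 (prettyPrint := false) "MTFlatSep[]" =>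
  ∀ (A : AbelianVariety ℂ), IsSmoothProjective A.dim A.X →
    ∀ (p : ℕ) (c : complexBetti A.X (2 * p)), IsRationalClass c →
      IsOfHodgeType A.dim A.X (2 * p) p p c →
        ∃ (𝒳 S : SchemeOver ℂ) (f : 𝒳 ⟶ S) (σ : ComplexPoints S → FiberClass f (2 * p))
          (s₁ : ComplexPoints S) (e : A.X ≅ fiberOver f s₁) (s₀ : ComplexPoints S),
          IsSmoothProjectiveFamily f A.dim ∧ IrreducibleSpace S.left ∧ AlgebraicGeometry.Smooth S.hom ∧
          IsSeparated S.hom ∧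
          (∀ s : ComplexPoints S, ∃ A' : AbelianVariety ℂ, A'.dim = A.dim ∧ Nonempty (A'.X ≅ fiberOver f s)) ∧
          Continuous σ ∧ (∀ s, (σ s).pt = s) ∧ (∀ s, σ s ∈ locusOfHodgeClasses f A.dim p) ∧
          σ s₁ = ⟨s₁, complexBetti.map e.inv (2 * p) c⟩ ∧
          s₀ ∈ cmLocus f A.dim

/-! ## §1 The node -/

/-- **`MumfordTateCMAnchorsSep` — Mumford–Tate CM anchors over a SEPARATED base (row b01's binder, separated
form).** Every rational `(p,p)` class `c` on a complex abelian variety `A` is, up to an iso `A.X ≅ 𝒳_{s₁}`, the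
restriction of a fibrewise rational `(p,p)` class `W` on the total space of a smooth projective abelian-fibred
family `f : 𝒳 ⟶ S` over a smooth irreducible base `S` SEPARATED over `ℂ`, with a CM fibre `A₀ ≅ 𝒳_{s₀}` (CM in the
`CMAbelianHodge` typing). Symbol for symbol the body of `MumfordTateCMAnchors` (`Ring2Hypotheses.lean` §1b) with the
single clause `IsSeparated S.hom` added = ring2-b01's file-local notation `MTAnchorsSep[]`
(`mumfordTateCMAnchorsSep_iff`, `Iff.rfl`). THEOREM IN PRINT in this form (every printed base is a quasi-projective
variety, hence separated): Deligne 1982 Prop. 6.1 with the finite-covering step of Thm. 2.15 and the global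
invariant cycle theorem = Charles–Schnell Thm. 11.5.11 (a)(b)(c); in the kernel it follows from the cited dense
record `Deligne1982.deligne1982_cmDenseMumfordTateFamilies` (`mumfordTateCMAnchorsSep_of_deligne1982`) and is, over
separated bases, the same statement as the curve form and the flat-section form (`…_iff_curve`, `…_iff_flatSep`).
NOT a case of HC; NOT a binder of record of the cell (row b01's binder stays `MumfordTateCMAnchors`, which it
implies by `mumfordTateCMAnchors_of_mumfordTateCMAnchorsSep` and — rev 2 — is EQUIVALENT to by ring2-b01 gen 10's
`mumfordTateCMAnchors_iff_sep`, re-keyed as `mumfordTateCMAnchorsSep_iff_mumfordTateCMAnchors` in §4). A hypothesis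
in Lean, never asserted.
[cite: CharlesSchnell2014Notes, Thm. 11.5.11 (pp. 516–518)] [cite: Deligne1982HodgeCycles, Prop. 6.1]
[cite: Abdulali1994FamiliesAV, p. 1122] [cite: MumfordAV1970, §6 Lemma] -/
@[conjecture] def MumfordTateCMAnchorsSep : Prop :=
  ∀ (A : AbelianVariety ℂ), IsSmoothProjective A.dim A.X →
    ∀ (p : ℕ) (c : complexBetti A.X (2 * p)), IsRationalClass c →
      IsOfHodgeType A.dim A.X (2 * p) p p c →
        ∃ (𝒳 S : SchemeOver ℂ) (f : 𝒳 ⟶ S) (s₁ s₀ : ComplexPoints S) (e : A.X ≅ fiberOver f s₁)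
          (W : complexBetti 𝒳 (2 * p)) (A₀ : AbelianVariety ℂ),
          IsSmoothProjectiveFamily f A.dim ∧ IrreducibleSpace S.left ∧ AlgebraicGeometry.Smooth S.hom ∧
          IsSeparated S.hom ∧
          (∀ s : ComplexPoints S, ∃ A' : AbelianVariety ℂ, A'.dim = A.dim ∧ Nonempty (A'.X ≅ fiberOver f s)) ∧
          (∀ s : ComplexPoints S, IsRationalClass (complexBetti.map (fiberι f s) (2 * p) W) ∧
            IsOfHodgeType A.dim (fiberOver f s) (2 * p) p p (complexBetti.map (fiberι f s) (2 * p) W)) ∧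
          complexBetti.map e.hom (2 * p) (complexBetti.map (fiberι f s₁) (2 * p) W) = c ∧
          A₀.dim = A.dim ∧ Nonempty (A₀.X ≅ fiberOver f s₀) ∧
          (∃ E : Subalgebra ℚ A₀.endAlgebra, IsReduced ↥E ∧ (∀ x ∈ E, ∀ y ∈ E, x * y = y * x) ∧
            Module.finrank ℚ ↥E = 2 * A₀.dim)

/-- **The node IS ring2-b01's notation `MTAnchorsSep[]`** (definitional). [folklore] -/
theorem mumfordTateCMAnchorsSep_iff : MumfordTateCMAnchorsSep ↔ MTAnchorsSep[] := Iff.rfl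

/-! ## §2 Row b01's arrows re-keyed on the named node (gen 8, `Ring2HypothesesMTAnchorsSeparatedBase`) -/

/-- **`MumfordTateCMAnchorsSep ⟹ MumfordTateCMAnchors`** — forget separatedness (gen 8's
`mumfordTateCMAnchors_of_sep`): the named node sits ABOVE row b01's binder of record; for the converse (rev 2) see
§4 `mumfordTateCMAnchorsSep_of_mumfordTateCMAnchors`. [folklore] -/
theorem mumfordTateCMAnchors_of_mumfordTateCMAnchorsSep (h : MumfordTateCMAnchorsSep) : MumfordTateCMAnchors :=
  mumfordTateCMAnchors_of_sep h

/-- **Over separated bases the binder IS its curve form: `MumfordTateCMAnchorsSep ↔ MTAnchorsCurve[]`** (gen 8's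
`mtAnchorsCurve_iff_sep`; Mumford's two-point lemma for separated irreducible varieties).
[cite: CharlesSchnell2014Notes, Thm. 11.5.11] [cite: MumfordAV1970, §6 Lemma] [cite: GortzWedhorn2020, Thm. 13.100] -/
theorem mumfordTateCMAnchorsSep_iff_curve : MumfordTateCMAnchorsSep ↔ MTAnchorsCurve[] :=
  mtAnchorsCurve_iff_sep.symm

/-- **`MumfordTateCMAnchorsSep ↔ MTFlatSep[]`** — separated base with a global class and one CM fibre ⟺ separated
base with a FLAT Hodge section and one CM point (gen 8's `mtAnchorsCurve_iff_sep`, `mtAnchorsCurve_iff_flatSep`).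
[cite: CharlesSchnell2014Notes, Thm. 11.5.11] [cite: MumfordAV1970, §6 Lemma] -/
theorem mumfordTateCMAnchorsSep_iff_flatSep : MumfordTateCMAnchorsSep ↔ MTFlatSep[] :=
  mtAnchorsCurve_iff_sep.symm.trans mtAnchorsCurve_iff_flatSep

/-- **KIND CITE binding: the refereed dense record gives the node** —
`Deligne1982.deligne1982_cmDenseMumfordTateFamilies ⟹ MumfordTateCMAnchorsSep` (BINDER-OWNERS G2 row c8: Deligne
1982 Prop. 6.1 in Charles–Schnell's dense global-class form, Thm. 11.5.11; a quasi-projective base is separated;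
gen 8's `mtFlatSep_of_deligne1982`, `mtAnchorsCurve_of_flatSep`, `mtAnchorsSep_of_curve`). CONDITIONAL on the
named fact (a hypothesis; not discharged). [cite: CharlesSchnell2014Notes, Thm. 11.5.11]
[cite: Deligne1982HodgeCycles, Prop. 6.1 and proof (pp. 71–73)] -/
theorem mumfordTateCMAnchorsSep_of_deligne1982 (h : deligne1982_cmDenseMumfordTateFamilies) :
    MumfordTateCMAnchorsSep :=
  mtAnchorsSep_of_curve (mtAnchorsCurve_of_flatSep (mtFlatSep_of_deligne1982 h))

/-! ## §3 Row b07's arrows re-keyed on the named node (gen 9, `Ring2HypothesesMTAnchorsCMAnchored`, p240326) -/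

/-- **`MumfordTateCMAnchorsSep ⟹ CMAnchoredFamilies` modulo Raynaud 1970** (row b01 over separated bases ⟹ row
b07's binder; gen 9's `cmAnchoredFamilies_of_mtAnchorsSep_of_raynaud1970`). CONDITIONAL on the cited record
`Motives.raynaud1970_abelianScheme_section_projective` (c20; a hypothesis, not discharged).
[cite: GortzWedhorn2023, §(27.53) Thm. 27.291] [cite: LaurentSchroer2023, §4 Prop. 4.3] [cite: MumfordAV1970, §6 Lemma] -/
theorem cmAnchoredFamilies_of_mumfordTateCMAnchorsSep_of_raynaud1970
    (hR : raynaud1970_abelianScheme_section_projective) (h : MumfordTateCMAnchorsSep) : CMAnchoredFamilies :=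
  cmAnchoredFamilies_of_mtAnchorsSep_of_raynaud1970 hR h

/-- **`CMAnchoredFamilies ⟹ MumfordTateCMAnchorsSep` modulo Catanese 2002** (gen 9's
`mtAnchorsSep_of_cmAnchoredFamilies_of_catanese2002`). CONDITIONAL on the cited record
`Motives.catanese2002_abelianFibres_of_abelianFibre` (c21; a hypothesis, not discharged).
[cite: Catanese2002DeformationTypes, Thm. 4.1 and Thm. 4.6] [cite: MumfordAV1970, §22] -/
theorem mumfordTateCMAnchorsSep_of_cmAnchoredFamilies_of_catanese2002
    (hCat : catanese2002_abelianFibres_of_abelianFibre) (h : CMAnchoredFamilies) : MumfordTateCMAnchorsSep :=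
  mtAnchorsSep_of_cmAnchoredFamilies_of_catanese2002 hCat h

/-- **Row b01 over separated bases and row b07 are ONE STATEMENT modulo the two cited records {Raynaud 1970,
Catanese 2002}: `MumfordTateCMAnchorsSep ↔ CMAnchoredFamilies`** (gen 9's
`mtAnchorsSep_iff_cmAnchoredFamilies_of_raynaud1970_of_catanese2002`). CONDITIONAL on both named facts
(hypotheses; neither discharged). LEAD L45.10: the two ROWS stay two rows, ANNOTATED — the binder of record of
row b01 is `MumfordTateCMAnchors` (all smooth irreducible bases), not this node.
[cite: GortzWedhorn2023, §(27.53) Thm. 27.291] [cite: Catanese2002DeformationTypes, Thm. 4.1 and Thm. 4.6]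
[cite: Deligne1982HodgeCycles, Prop. 6.1] -/
theorem mumfordTateCMAnchorsSep_iff_cmAnchoredFamilies_of_raynaud1970_of_catanese2002
    (hR : raynaud1970_abelianScheme_section_projective) (hCat : catanese2002_abelianFibres_of_abelianFibre) :
    MumfordTateCMAnchorsSep ↔ CMAnchoredFamilies :=
  mtAnchorsSep_iff_cmAnchoredFamilies_of_raynaud1970_of_catanese2002 hR hCat

/-! ## §4 (rev 2) Row b01's binder AS TYPED re-keyed on the named node (gen 10, `Ring2HypothesesMTAnchorsAsTyped`) -/

/-- **`MumfordTateCMAnchors ⟹ MumfordTateCMAnchorsSep`** — rev 1's non-separated typing residual, CLOSED by ring2-b01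
gen 10 (`mumfordTateCMAnchors_iff_sep`: any two complex points of a smooth irreducible ℂ-scheme, separated or not, lie
on the image of a smooth irreducible affine curve — `Motives.mumford_smoothCurve_through_two_points_of_irreducibleSpace_of_smooth`
— so the binder AS TYPED is its curve form, whose base is separated). One-line re-keying; count once ring2-b01.
[cite: MumfordAV1970, §6 Lemma] [cite: CharlesSchnell2014Notes, Thm. 11.5.11] -/
theorem mumfordTateCMAnchorsSep_of_mumfordTateCMAnchors (h : MumfordTateCMAnchors) : MumfordTateCMAnchorsSep :=
  mumfordTateCMAnchors_iff_sep.mp h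

/-- **The named node IS row b01's binder AS TYPED: `MumfordTateCMAnchorsSep ↔ MumfordTateCMAnchors`** (ring2-b01 gen
10's `mumfordTateCMAnchors_iff_sep`, re-keyed; with §3, rows b01 and b07 are one statement AS TYPED modulo {c20, c21} —
ring2-b01's `mumfordTateCMAnchors_iff_cmAnchoredFamilies_of_raynaud1970_of_catanese2002`; LEAD L45.10: the two ROWS
stay two rows, annotated). [cite: MumfordAV1970, §6 Lemma] [cite: CharlesSchnell2014Notes, Thm. 11.5.11]
[cite: Deligne1982HodgeCycles, Prop. 6.1] -/
theorem mumfordTateCMAnchorsSep_iff_mumfordTateCMAnchors : MumfordTateCMAnchorsSep ↔ MumfordTateCMAnchors :=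
  ⟨mumfordTateCMAnchors_of_mumfordTateCMAnchorsSep, mumfordTateCMAnchorsSep_of_mumfordTateCMAnchors⟩

/-! ## Audit
No `sorry`; no new named fact; `HC_CM` / `HC_AV` do not occur; one `@[conjecture] def` (a hypothesis wherever used;
body byte-identical to rev 1); every theorem is a one-line re-keying of a tree theorem of ring2-b01 (count once
ring2-b01). Standard axioms only. -/

end Summit.HodgeConjecture.HodgeConjecture.Ring2.Hypotheses

end
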